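import Literature.RepresentationTheory.Kovacevic2021.SU21KTypeMultiplicity
import Literature.Algebra.Lie.ChevalleyEilenbergComplex
import HarnessLib

/-!
# Kovačević's `SU(2,1)`-modules: the relative `(𝔤, 𝔨)`-cochains in degrees `0` and `1` on the tree's
# Chevalley–Eilenberg carriers

Topic `RepresentationTheory/Kovacevic2021`; namespace `Literature.RepresentationTheory.Kovacevic2021`.
Definitions with bodies and theorems only; no named fact.

Let `𝔤 = 𝔤𝔩(3,ℂ) ⊃ 𝔰𝔩(3,ℂ) = 𝔰𝔲(2,1)_ℂ` (matrices, commutator bracket) and `𝔨 ⊂ 𝔤` the block-diagonal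
subalgebra `𝔤𝔩(2) ⊕ 𝔤𝔩(1)` (`kSub`; rows/columns `{0,1} ⊔ {2}`), so that `𝔤 = 𝔨 ⊕ 𝔭`,
`𝔭 = 𝔭⁺ ⊕ 𝔭⁻ = ⟨E₀₂, E₁₂⟩ ⊕ ⟨E₂₀, E₂₁⟩`.  For a `K`-type datum `𝒟 : SU21Datum` [Kovacevic2021, §3] the
module `V = 𝒟.V` is a Lie module over `𝔤` (`SU21ModulesFromKTypes`), and the tree's relative
Chevalley–Eilenberg complex `C^q(𝔤, 𝔨; V)` (`Literature.Algebra.Lie.ChevalleyEilenberg.Subcomplex.rel`: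
cochains `f : Λ^q 𝔤 → V` with `i_x f = 0` and `θ_x f = 0` for `x ∈ 𝔨` [ChevalleyEilenberg1948, §28;
BorelWallach2000, I §1.2]) is available for it.  This file computes that complex in degrees `0` and `1`:

* **`C⁰(𝔤, 𝔨; V) = V^𝔨 = {𝔨-highest-weight vectors of type (1,0)} = ℂ u^1_{1,0}`**
  (`mem_relCochain_zero_iff`, `kInvariant_iff_mem_hwSpace`), of dimension `[(1,0) ∈ S]`
  (`finrank_relCochain_zero`);
* **`C¹(𝔤, 𝔨; V) = Hom_𝔨(𝔭, V) ≅ {hw vectors of type (2,3)} × {hw vectors of type (2,-3)}`**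
  via `f ↦ (f(E₀₂), f(E₂₁))` (`E₀₂`, `E₂₁` are the `𝔨`-highest-weight vectors of `𝔭⁺ ≅ F_{1,0} = V_{2,3}`
  and `𝔭⁻ ≅ F_{0,1} = V_{2,-3}`): `relCochainOneEquiv`, whence
  `dim C¹(𝔤, 𝔨; V) = [(2,3) ∈ S] + [(2,-3) ∈ S]` (`finrank_relCochain_one`) — Borel–Wallach's
  `C^q(𝔤,𝔨;V) = Hom_𝔨(Λ^q 𝔭, V)` [BorelWallach2000, I 1.2, II 3.1] in degree `1` with
  `Λ¹𝔭 = F_{1,0} ⊕ F_{0,1}` [VI 4.8 (5)], combined with multiplicity one (`SU21KTypeMultiplicity`);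
* a relative `1`-cochain is `y ↦ y₀₂ w₁ + y₁₂ Y_α w₁ + y₂₁ w₂ - y₂₀ Y_α w₂` for its two values
  `w₁ = f(E₀₂)`, `w₂ = f(E₂₁)` (`eq_pairCochain`, `pairCochain_mem`).
The sequel `SU21CohomologyDegreeOne` evaluates this on the six cohomological modules of `SU(2,1)` and computes
their `H¹(𝔤, 𝔨; V)` [BorelWallach2000, VI Thm 4.11 at `n = 2`].

NOT here: degrees `q ≥ 2` (the identification `C^q(𝔤,𝔨;V) = Hom_𝔨(Λ^q 𝔭, V)` is in the tree only for
`q ≤ 1`, through `d_one_apply` / `lieDer_one_apply`); the `(𝔤, K)`-complex of the disconnected /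
real group (here `K = S(U(2)×U(1))` is connected and `C^q(𝔤,K;V) = C^q(𝔤,𝔨;V)`).

## References

* A. Borel, N. Wallach (2000), I §1.2 (1)–(3) p. 8; VI 4.7–4.8 pp. 130–131 (held chunks p0059,
  p0165–p0166). [BorelWallach2000]
* C. Chevalley, S. Eilenberg, Trans. AMS 63 (1948), §23, §28. [ChevalleyEilenberg1948]
* D. Kovačević, Acta Math. Spalatensia 1 (2021) 105–125, §3 Def 1, Thm 1. [Kovacevic2021]
-/

noncomputable section

open Finsupp Module
open Literature.Algebra.Lie Literature.Algebra.Lie.ChevalleyEilenberg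

namespace Literature.RepresentationTheory.Kovacevic2021

-- Mathlib idiom (Mathlib/Algebra/Lie/OfAssociative.lean): bracket on `Matrix`/`Module.End` = commutator.
attribute [local instance 100] LieRing.ofAssociativeRing

/-- `𝔤𝔩(3,ℂ) = 𝔲(2,1)_ℂ` as a complex Lie algebra of matrices (commutator bracket). [folklore] -/
abbrev gl3 : Type := Matrix (Fin 3) (Fin 3) ℂ

/-- The block-diagonal subalgebra **`𝔨 = 𝔤𝔩(2,ℂ) ⊕ 𝔤𝔩(1,ℂ) ⊂ 𝔤𝔩(3,ℂ)`** (complexified Lie algebra of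
`K = S(U(2) × U(1))`, up to the centre): matrices with vanishing `(0,2), (1,2), (2,0), (2,1)` entries.
[cite: BorelWallach2000, VI 4.7] [cite: Kovacevic2021, §3] -/
def kSub : LieSubalgebra ℂ gl3 :=
  { carrier := {M : gl3 | M 0 2 = 0 ∧ M 1 2 = 0 ∧ M 2 0 = 0 ∧ M 2 1 = 0}
    add_mem' := by
      rintro M N ⟨h1, h2, h3, h4⟩ ⟨h1', h2', h3', h4'⟩
      simp only [Set.mem_setOf_eq, Matrix.add_apply, h1, h2, h3, h4, h1', h2', h3', h4', add_zero, and_self]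
    zero_mem' := by simp
    smul_mem' := by
      rintro c M ⟨h1, h2, h3, h4⟩
      simp only [Set.mem_setOf_eq, Matrix.smul_apply, h1, h2, h3, h4, smul_zero, and_self]
    lie_mem' := by
      rintro M N ⟨h1, h2, h3, h4⟩ ⟨h1', h2', h3', h4'⟩
      simp only [Set.mem_setOf_eq, LieRing.of_associative_ring_bracket, Matrix.sub_apply, Matrix.mul_apply,
        Fin.sum_univ_three, h1, h2, h3, h4, h1', h2', h3', h4', mul_zero, zero_mul, add_zero, sub_self,
        and_self] }

/-- membership in `𝔨`: the four off-block entries vanish [cite: BorelWallach2000, VI 4.7] -/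
theorem mem_kSub_iff (M : gl3) : M ∈ kSub ↔ M 0 2 = 0 ∧ M 1 2 = 0 ∧ M 2 0 = 0 ∧ M 2 1 = 0 := Iff.rfl

namespace SU21Datum

/-- the matrix units `E₀₀, E₀₁, E₁₀, E₁₁, E₂₂` lie in `𝔨` [cite: BorelWallach2000, VI 4.7] -/
theorem E_mem_kSub (i j : Fin 3) (h : (i = 2 ↔ j = 2)) : E i j ∈ kSub := by
  rw [mem_kSub_iff]
  fin_cases i <;> fin_cases j <;> simp_all

variable (𝒟 : SU21Datum)

/-- The relative `(𝔤, 𝔨)`-cochains `C^q(𝔤𝔩₃, 𝔨; V)` of the datum's module, on the tree's Chevalley–Eilenberg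
carriers. [cite: BorelWallach2000, I §1.2 (1)] -/
abbrev relCochain (q : ℕ) : Submodule ℂ (Cochain ℂ gl3 𝒟.V q) := (Subcomplex.rel ℂ gl3 𝒟.V kSub).carrier q

/-! ### Degree `0`: `C⁰(𝔤, 𝔨; V) = V^𝔨 = ℂ u^1_{1,0}` -/

variable {𝒟} in
/-- **`𝔨`-invariant vectors are the `𝔨`-highest-weight vectors of type `(1,0)`**: `⁅x, w⁆ = 0` for all
`x ∈ 𝔨` iff `X_α w = 0`, `H_α w = 0`, `Z w = 0` (then also `Y_α w = 0`, as `w ∈ ℂ u^1_{1,0}`).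
[cite: Kovacevic2021, §3 Def 1] [cite: BorelWallach2000, VI 4.8 (`F_{0,0} = ℂ`)] -/
theorem kInvariant_iff_mem_hwSpace (w : 𝒟.V) : (∀ x ∈ kSub, ⁅x, w⁆ = 0) ↔ w ∈ 𝒟.hwSpace 1 0 := by
  constructor
  · intro h
    rw [mem_hwSpace_iff_lie]
    refine ⟨h _ (E_mem_kSub 0 1 (by decide)), ?_, ?_⟩
    · rw [h _ (kSub.sub_mem (E_mem_kSub 0 0 (by decide)) (E_mem_kSub 1 1 (by decide)))]
      simp
    · rw [h _ (kSub.sub_mem (kSub.add_mem (E_mem_kSub 0 0 (by decide)) (E_mem_kSub 1 1 (by decide)))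
        (kSub.smul_mem _ (E_mem_kSub 2 2 (by decide))))]
      simp
  · intro hw x hx
    rw [hwSpace_eq_span, Submodule.mem_span_singleton] at hw
    obtain ⟨c, rfl⟩ := hw
    obtain ⟨h02, h12, h20, h21⟩ := (mem_kSub_iff x).1 hx
    rw [lie_smul, lie_def]
    simp only [ρfun, h02, h12, h20, h21, zero_smul, add_zero, LinearMap.add_apply, LinearMap.smul_apply,
      Ha_vec, Hb_vec, Xa_vec, Ya_vec 1 0 le_rfl, smul_smul]
    rw [vec_of_not_range (𝒟 := 𝒟) 0 (show (1 : ℤ) + 1 < 1 ∨ (1 : ℤ) < 1 + 1 by omega),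
      vec_of_not_range (𝒟 := 𝒟) 0 (show (1 : ℤ) - 1 < 1 ∨ (1 : ℤ) < 1 - 1 by omega)]
    push_cast
    module

/-- **`C⁰(𝔤, 𝔨; V)`**: a `0`-cochain (a vector of `V`) is relative iff its value is `𝔨`-invariant, i.e. a
`𝔨`-highest-weight vector of type `(1,0)`. [cite: BorelWallach2000, I §1.2 (3)] -/
theorem mem_relCochain_zero_iff (f : Cochain ℂ gl3 𝒟.V 0) :
    f ∈ 𝒟.relCochain 0 ↔ f ![] ∈ 𝒟.hwSpace 1 0 := by
  rw [relCochain, Subcomplex.mem_rel_zero_iff, ← kInvariant_iff_mem_hwSpace]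
  refine forall₂_congr fun x _ => ?_
  constructor
  · intro h
    have e := congrArg (fun φ : Cochain ℂ gl3 𝒟.V 0 => φ ![]) h
    simpa using e
  · intro h
    ext v
    rw [lieDer_zero_apply, AlternatingMap.zero_apply, show v = ![] from Subsingleton.elim _ _, h]

/-- **`C⁰(𝔤, 𝔨; V) ≅ {𝔨-highest-weight vectors of type (1,0)}`** (`= ℂ u^1_{1,0}`), by evaluation.
[cite: BorelWallach2000, I §1.2 (3)] -/
def relCochainZeroEquiv : 𝒟.relCochain 0 ≃ₗ[ℂ] 𝒟.hwSpace 1 0 where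
  toFun f := ⟨f.1 ![], (𝒟.mem_relCochain_zero_iff f.1).1 f.2⟩
  map_add' _ _ := rfl
  map_smul' _ _ := rfl
  invFun w := ⟨AlternatingMap.constOfIsEmpty ℂ gl3 (Fin 0) w.1,
    (𝒟.mem_relCochain_zero_iff _).2 (by exact w.2)⟩
  left_inv f := by
    apply Subtype.ext
    ext v
    rw [show v = ![] from Subsingleton.elim _ _]
    rfl
  right_inv w := rfl

open Classical in
/-- **`dim C⁰(𝔤, 𝔨; V) = [(1,0) ∈ S]`**. [cite: BorelWallach2000, VI Thm 4.11 (3) (`q = 0`)] -/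
theorem finrank_relCochain_zero : finrank ℂ (𝒟.relCochain 0) = if ((1 : ℤ), (0 : ℤ)) ∈ 𝒟.S then 1 else 0 := by
  rw [LinearEquiv.finrank_eq 𝒟.relCochainZeroEquiv, finrank_hwSpace]


/-! ### Degree `1`: `C¹(𝔤, 𝔨; V) = Hom_𝔨(𝔭, V) ≅ {hw vectors of type (2,3)} × {hw vectors of type (2,-3)}` -/

section DegreeOne

variable {𝒟}

/-- a `1`-cochain only sees `v 0` [folklore] -/
private theorem cochain_one_apply_eq (f : Cochain ℂ gl3 𝒟.V 1) (v : Fin 1 → gl3) : f v = f ![v 0] := by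
  congr 1
  ext i
  fin_cases i
  rfl

/-- updating the single slot [folklore] -/
private theorem update_vec_one (w y : gl3) : Function.update ![w] 0 y = ![y] := by
  ext i
  fin_cases i
  simp

/-- additivity of a `1`-cochain in its slot [folklore] -/
private theorem cochain_one_map_add (f : Cochain ℂ gl3 𝒟.V 1) (y z : gl3) : f ![y + z] = f ![y] + f ![z] := by
  have h := f.map_update_add (v := ![(0 : gl3)]) 0 y z
  simpa only [update_vec_one] using h

/-- homogeneity of a `1`-cochain in its slot [folklore] -/
private theorem cochain_one_map_smul (f : Cochain ℂ gl3 𝒟.V 1) (c : ℂ) (y : gl3) : f ![c • y] = c • f ![y] := by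
  have h := f.map_update_smul (v := ![(0 : gl3)]) 0 c y
  simpa only [update_vec_one] using h

/-- `f ![-y] = -f ![y]` [folklore] -/
private theorem cochain_one_map_neg (f : Cochain ℂ gl3 𝒟.V 1) (y : gl3) : f ![-y] = -f ![y] := by
  rw [← neg_one_smul ℂ y, cochain_one_map_smul, neg_one_smul]

/-- `f ![0] = 0` [folklore] -/
private theorem cochain_one_map_zero (f : Cochain ℂ gl3 𝒟.V 1) : f ![(0 : gl3)] = 0 := by
  rw [← zero_smul ℂ (0 : gl3), cochain_one_map_smul, zero_smul]

variable (𝒟) in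
/-- **`C¹(𝔤, 𝔨; V)`**: a `1`-cochain `f : 𝔤 → V` is relative iff it is `𝔨`-equivariant
(`⁅x, f(y)⁆ = f(⁅x, y⁆)` for `x ∈ 𝔨`) and vanishes on `𝔨` — i.e. a `𝔨`-map `𝔤/𝔨 = 𝔭 → V`.
[cite: BorelWallach2000, I §1.2 (1)] [cite: ChevalleyEilenberg1948, §28 (28.1)–(28.2)] -/
theorem mem_relCochain_one_iff (f : Cochain ℂ gl3 𝒟.V 1) :
    f ∈ 𝒟.relCochain 1 ↔ (∀ x ∈ kSub, ∀ y : gl3, ⁅x, f ![y]⁆ = f ![⁅x, y⁆]) ∧ ∀ x ∈ kSub, f ![x] = 0 := by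
  rw [relCochain, Subcomplex.mem_rel_succ_iff]
  constructor
  · intro h
    refine ⟨fun x hx y => ?_, fun x hx => ?_⟩
    · have e : lieDer ℂ gl3 𝒟.V 1 x f ![y] = (0 : Cochain ℂ gl3 𝒟.V 1) ![y] := by rw [(h x hx).1]
      rwa [lieDer_one_apply, AlternatingMap.zero_apply, sub_eq_zero] at e
    · have e := congrArg (fun φ : Cochain ℂ gl3 𝒟.V 0 => φ ![]) (h x hx).2
      simpa using e
  · rintro ⟨h1, h2⟩ x hx
    refine ⟨?_, ?_⟩
    · refine AlternatingMap.ext fun v => ?_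
      rw [cochain_one_apply_eq _ v, lieDer_one_apply, AlternatingMap.zero_apply, h1 x hx, sub_self]
    · refine AlternatingMap.ext fun v => ?_
      rw [ins_apply, AlternatingMap.zero_apply, show v = ![] from Subsingleton.elim _ _]
      exact h2 x hx

/-! #### Matrix identities in `𝔤𝔩₃` -/

/-- `⁅E₀₁, E₀₂⁆ = 0`, `⁅E₀₀ - E₁₁, E₀₂⁆ = E₀₂`, `⁅Z, E₀₂⁆ = 3E₀₂`: `E₀₂` is the `𝔨`-highest-weight vector of
`𝔭⁺ ≅ V_{2,3}`. [cite: Kovacevic2021, §3 (`𝔭⁺ = V_{2,3}`)] -/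
theorem lie_E02 :
    ⁅E 0 1, E 0 2⁆ = 0 ∧ ⁅E 0 0 - E 1 1, E 0 2⁆ = E 0 2 ∧ ⁅E 0 0 + E 1 1 - (2 : ℂ) • E 2 2, E 0 2⁆ = (3 : ℂ) • E 0 2 := by
  refine ⟨?_, ?_, ?_⟩
  all_goals
    ext a b
    fin_cases a <;> fin_cases b <;>
      simp [LieRing.of_associative_ring_bracket, Matrix.mul_apply, Matrix.single_apply]
  all_goals norm_num

/-- `⁅E₀₁, E₂₁⁆ = 0`, `⁅E₀₀ - E₁₁, E₂₁⁆ = E₂₁`, `⁅Z, E₂₁⁆ = -3E₂₁`: `E₂₁` is the `𝔨`-highest-weight vector of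
`𝔭⁻ ≅ V_{2,-3}`. [cite: Kovacevic2021, §3 (`𝔭⁻ = V_{2,-3}`)] -/
theorem lie_E21 :
    ⁅E 0 1, E 2 1⁆ = 0 ∧ ⁅E 0 0 - E 1 1, E 2 1⁆ = E 2 1 ∧
      ⁅E 0 0 + E 1 1 - (2 : ℂ) • E 2 2, E 2 1⁆ = (-3 : ℂ) • E 2 1 := by
  refine ⟨?_, ?_, ?_⟩
  all_goals
    ext a b
    fin_cases a <;> fin_cases b <;>
      simp [LieRing.of_associative_ring_bracket, Matrix.mul_apply, Matrix.single_apply]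
  all_goals norm_num

/-- `⁅E₁₀, E₀₂⁆ = E₁₂` and `⁅E₁₀, E₂₁⁆ = -E₂₀`: `Y_α` moves the highest-weight vectors of `𝔭^±` to the other
basis vector. [cite: Kovacevic2021, §3 Def 1] -/
theorem lie_E10 : ⁅E 1 0, E 0 2⁆ = E 1 2 ∧ ⁅E 1 0, E 2 1⁆ = -E 2 0 := by
  refine ⟨?_, ?_⟩
  all_goals
    ext a b
    fin_cases a <;> fin_cases b <;>
      simp [LieRing.of_associative_ring_bracket]

/-- the `𝔨`-part of a matrix: subtract the `𝔭`-entries [cite: BorelWallach2000, VI 4.7] -/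
def kPart (y : gl3) : gl3 := y - y 0 2 • E 0 2 - y 1 2 • E 1 2 - y 2 0 • E 2 0 - y 2 1 • E 2 1

/-- `kPart y ∈ 𝔨` [cite: BorelWallach2000, VI 4.7] -/
theorem kPart_mem (y : gl3) : kPart y ∈ kSub := by
  rw [mem_kSub_iff]
  simp [kPart]

/-- `y = kPart y + y₀₂ E₀₂ + y₁₂ E₁₂ + y₂₀ E₂₀ + y₂₁ E₂₁` (`𝔤 = 𝔨 ⊕ 𝔭`) [cite: BorelWallach2000, VI 4.7] -/
theorem kPart_add (y : gl3) : kPart y + y 0 2 • E 0 2 + y 1 2 • E 1 2 + y 2 0 • E 2 0 + y 2 1 • E 2 1 = y := by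
  simp only [kPart]
  abel

/-! #### The values of a relative `1`-cochain -/

/-- `f(E₀₂)` is a `𝔨`-highest-weight vector of type `(2,3)`. [cite: BorelWallach2000, VI 4.8 (5) (`Λ^{1,0} = F_{1,0}`)] -/
theorem apply_E02_mem_hwSpace {f : Cochain ℂ gl3 𝒟.V 1} (hf : f ∈ 𝒟.relCochain 1) :
    f ![E 0 2] ∈ 𝒟.hwSpace 2 3 := by
  obtain ⟨h1, -⟩ := (𝒟.mem_relCochain_one_iff f).1 hf
  obtain ⟨e1, e2, e3⟩ := lie_E02
  rw [mem_hwSpace_iff_lie, h1 _ (E_mem_kSub 0 1 (by decide)), e1, cochain_one_map_zero,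
    h1 _ (kSub.sub_mem (E_mem_kSub 0 0 (by decide)) (E_mem_kSub 1 1 (by decide))), e2,
    h1 _ (kSub.sub_mem (kSub.add_mem (E_mem_kSub 0 0 (by decide)) (E_mem_kSub 1 1 (by decide)))
      (kSub.smul_mem _ (E_mem_kSub 2 2 (by decide)))), e3, cochain_one_map_smul]
  norm_num

/-- `f(E₂₁)` is a `𝔨`-highest-weight vector of type `(2,-3)`. [cite: BorelWallach2000, VI 4.8 (5) (`Λ^{0,1} = F_{0,1}`)] -/
theorem apply_E21_mem_hwSpace {f : Cochain ℂ gl3 𝒟.V 1} (hf : f ∈ 𝒟.relCochain 1) :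
    f ![E 2 1] ∈ 𝒟.hwSpace 2 (-3) := by
  obtain ⟨h1, -⟩ := (𝒟.mem_relCochain_one_iff f).1 hf
  obtain ⟨e1, e2, e3⟩ := lie_E21
  rw [mem_hwSpace_iff_lie, h1 _ (E_mem_kSub 0 1 (by decide)), e1, cochain_one_map_zero,
    h1 _ (kSub.sub_mem (E_mem_kSub 0 0 (by decide)) (E_mem_kSub 1 1 (by decide))), e2,
    h1 _ (kSub.sub_mem (kSub.add_mem (E_mem_kSub 0 0 (by decide)) (E_mem_kSub 1 1 (by decide)))
      (kSub.smul_mem _ (E_mem_kSub 2 2 (by decide)))), e3, cochain_one_map_smul]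
  norm_num

variable (𝒟) in
/-- The `𝔨`-map `𝔭 → V` with prescribed values on the highest-weight vectors `E₀₂`, `E₂₁` of `𝔭⁺`, `𝔭⁻`,
extended by `0` on `𝔨`: `M ↦ M₀₂ w₁ + M₁₂ Y_α w₁ + M₂₁ w₂ - M₂₀ Y_α w₂`. [cite: BorelWallach2000, I §1.2 (1)] -/
def pairMap (w₁ w₂ : 𝒟.V) : gl3 →ₗ[ℂ] 𝒟.V where
  toFun M := M 0 2 • w₁ + M 1 2 • 𝒟.Ya w₁ + M 2 1 • w₂ - M 2 0 • 𝒟.Ya w₂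
  map_add' M N := by
    simp only [Matrix.add_apply]
    module
  map_smul' c M := by
    simp only [Matrix.smul_apply, smul_eq_mul, RingHom.id_apply]
    module

/-- unfolding `pairMap` [cite: BorelWallach2000, I §1.2 (1)] -/
theorem pairMap_apply (w₁ w₂ : 𝒟.V) (M : gl3) :
    𝒟.pairMap w₁ w₂ M = M 0 2 • w₁ + M 1 2 • 𝒟.Ya w₁ + M 2 1 • w₂ - M 2 0 • 𝒟.Ya w₂ := rfl

variable (𝒟) in
/-- the `1`-cochain attached to `pairMap` [cite: BorelWallach2000, I §1.2 (1)] -/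
def pairCochain (w₁ w₂ : 𝒟.V) : Cochain ℂ gl3 𝒟.V 1 :=
  AlternatingMap.ofSubsingleton ℂ gl3 𝒟.V (0 : Fin 1) (𝒟.pairMap w₁ w₂)

/-- `pairCochain w₁ w₂ ![y] = pairMap w₁ w₂ y` [cite: BorelWallach2000, I §1.2 (1)] -/
@[simp] theorem pairCochain_apply (w₁ w₂ : 𝒟.V) (v : Fin 1 → gl3) :
    𝒟.pairCochain w₁ w₂ v = 𝒟.pairMap w₁ w₂ (v 0) := rfl

/-- **A relative `1`-cochain is determined by its two values `f(E₀₂)`, `f(E₂₁)`**: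
`f(y) = y₀₂ f(E₀₂) + y₁₂ Y_α f(E₀₂) + y₂₁ f(E₂₁) - y₂₀ Y_α f(E₂₁)` (vanishing on `𝔨` and
`E₁₂ = ⁅E₁₀, E₀₂⁆`, `E₂₀ = -⁅E₁₀, E₂₁⁆`). [cite: BorelWallach2000, I §1.2 (1)] -/
theorem eq_pairCochain {f : Cochain ℂ gl3 𝒟.V 1} (hf : f ∈ 𝒟.relCochain 1) :
    f = 𝒟.pairCochain (f ![E 0 2]) (f ![E 2 1]) := by
  obtain ⟨h1, h2⟩ := (𝒟.mem_relCochain_one_iff f).1 hf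
  have h12 : f ![E 1 2] = 𝒟.Ya (f ![E 0 2]) := by
    rw [← lie_E10.1, ← h1 _ (E_mem_kSub 1 0 (by decide)), lie_def, ρfun_E]
  have h20 : f ![E 2 0] = -𝒟.Ya (f ![E 2 1]) := by
    rw [← neg_neg (E 2 0), ← lie_E10.2, cochain_one_map_neg, ← h1 _ (E_mem_kSub 1 0 (by decide)), lie_def,
      ρfun_E]
  refine AlternatingMap.ext fun v => ?_
  rw [cochain_one_apply_eq f v, pairCochain_apply, pairMap_apply]
  set y := v 0
  conv_lhs => rw [← kPart_add y]
  rw [cochain_one_map_add, cochain_one_map_add, cochain_one_map_add, cochain_one_map_add, h2 _ (kPart_mem y),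
    cochain_one_map_smul, cochain_one_map_smul, cochain_one_map_smul, cochain_one_map_smul, h12, h20, zero_add,
    smul_neg]
  abel

-- uniform expansion of the `𝔨`-action on `u^1_{2,±3}`, `u^2_{2,±3}`; which simp lemmas fire varies with the term
set_option linter.unusedSimpArgs false in
/-- **The `pairCochain` of two highest-weight vectors is a relative cochain** (the `𝔨`-equivariance of
`pairMap` on `𝔭 = V_{2,3} ⊕ V_{2,-3}`, checked on the basis `u^1, u^2 = -Y_α u^1` of both `K`-types).
[cite: BorelWallach2000, I §1.2 (1)] [cite: Kovacevic2021, §3 Def 1] -/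
theorem pairCochain_mem {w₁ w₂ : 𝒟.V} (hw₁ : w₁ ∈ 𝒟.hwSpace 2 3) (hw₂ : w₂ ∈ 𝒟.hwSpace 2 (-3)) :
    𝒟.pairCochain w₁ w₂ ∈ 𝒟.relCochain 1 := by
  rw [hwSpace_eq_span, Submodule.mem_span_singleton] at hw₁ hw₂
  obtain ⟨c₁, rfl⟩ := hw₁
  obtain ⟨c₂, rfl⟩ := hw₂
  rw [mem_relCochain_one_iff]
  refine ⟨fun x hx y => ?_, fun x hx => ?_⟩
  · obtain ⟨h02, h12, h20, h21⟩ := (mem_kSub_iff x).1 hx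
    rw [pairCochain_apply, pairCochain_apply, Matrix.cons_val_zero, Matrix.cons_val_zero, pairMap_apply,
      pairMap_apply, lie_def]
    simp (disch := omega) only [ρfun, h02, h12, h20, h21, zero_smul, add_zero, LinearMap.add_apply,
      LinearMap.smul_apply, map_add, map_sub, map_smul, map_neg, LieRing.of_associative_ring_bracket,
      Matrix.sub_apply, Matrix.mul_apply, Fin.sum_univ_three, Ha_vec, Hb_vec, Xa_vec, Ya_vec 2 3 le_rfl,
      Ya_vec 2 (-3) le_rfl, Ya_vec 2 3 (show (1 : ℤ) ≤ 1 + 1 by omega),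
      Ya_vec 2 (-3) (show (1 : ℤ) ≤ 1 + 1 by omega), vec_of_not_range, smul_add, smul_sub, smul_neg, smul_smul,
      smul_zero, neg_zero, Int.cast_add, Int.cast_sub, Int.cast_one, Int.cast_ofNat, Int.cast_zero, Int.cast_neg,
      mul_zero, zero_mul, sub_zero, zero_add, add_zero, neg_neg, add_sub_cancel_right, sub_add_cancel]
    match_scalars <;> ring
  · obtain ⟨h02, h12, h20, h21⟩ := (mem_kSub_iff x).1 hx
    rw [pairCochain_apply, Matrix.cons_val_zero, pairMap_apply, h02, h12, h20, h21]
    simp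

variable (𝒟) in
/-- **`C¹(𝔤, 𝔨; V) ≅ Hom_𝔨(𝔭⁺, V) × Hom_𝔨(𝔭⁻, V) ≅ {hw vectors of type (2,3)} × {hw vectors of type (2,-3)}`**,
`f ↦ (f(E₀₂), f(E₂₁))`. [cite: BorelWallach2000, I §1.2 (1), VI 4.8 (5)] -/
def relCochainOneEquiv : 𝒟.relCochain 1 ≃ₗ[ℂ] (𝒟.hwSpace 2 3 × 𝒟.hwSpace 2 (-3)) where
  toFun f := (⟨f.1 ![E 0 2], apply_E02_mem_hwSpace f.2⟩, ⟨f.1 ![E 2 1], apply_E21_mem_hwSpace f.2⟩)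
  map_add' _ _ := rfl
  map_smul' _ _ := rfl
  invFun w := ⟨𝒟.pairCochain w.1.1 w.2.1, pairCochain_mem w.1.2 w.2.2⟩
  left_inv f := Subtype.ext (eq_pairCochain f.2).symm
  right_inv w := by
    ext <;> simp [pairMap_apply]

variable (𝒟) in
/-- the highest-weight lines are finite-dimensional [cite: Kovacevic2021, §3 Def 1] -/
instance finiteDimensional_hwSpace (n m : ℤ) : FiniteDimensional ℂ (𝒟.hwSpace n m) := by
  rw [hwSpace_eq_span]
  infer_instance

variable (𝒟) in
/-- the highest-weight lines are free `ℂ`-modules (recorded explicitly: instance search does not find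
`Module.Free.of_divisionRing` through the `Finsupp` carrier) [folklore] -/
instance free_hwSpace (n m : ℤ) : Module.Free ℂ (𝒟.hwSpace n m) := Module.Free.of_divisionRing ℂ (𝒟.hwSpace n m)

variable (𝒟) in
open Classical in
/-- **`dim C¹(𝔤, 𝔨; V) = [(2,3) ∈ S] + [(2,-3) ∈ S]`** (`Λ¹𝔭 = F_{1,0} ⊕ F_{0,1} = V_{2,3} ⊕ V_{2,-3}`, each
occurring in `V` at most once). [cite: BorelWallach2000, VI 4.8 (5), Thm 4.11 (11)] -/
theorem finrank_relCochain_one :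
    finrank ℂ (𝒟.relCochain 1) =
      (if ((2 : ℤ), (3 : ℤ)) ∈ 𝒟.S then 1 else 0) + (if ((2 : ℤ), (-3 : ℤ)) ∈ 𝒟.S then 1 else 0) := by
  rw [LinearEquiv.finrank_eq 𝒟.relCochainOneEquiv, Module.finrank_prod, finrank_hwSpace, finrank_hwSpace]

end DegreeOne

end SU21Datum

end Literature.RepresentationTheory.Kovacevic2021
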